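import Literature.AlgebraicGeometry.Resolution.ArithmeticalThreefoldsMonomials
import HarnessLib

/-!
# Cossart–Piltant 2019, (510) ⇒ (512): shape elements from denominators dividing a power of `h`

Topic: `Literature/AlgebraicGeometry/Resolution` (proofs only; no new notions, no new named
facts). In the proof of Cossart–Piltant's Prop. 4.8 (J. Algebra 529 (2019) = arXiv:1412.0868,
arXiv v1 Prop. 4.6 p. 53) the model `Ŷ → Spec Â` is an isomorphism above `Spec Â_g` with
`g ∣ h` ((510): "there exists `g ∈ A`, `g ≠ 0` such that `π̂` is an isomorphism above `𝒳̂_g`"),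
so every element `y` of `S = 𝒪_{Ŷ,ŷ}` satisfies `b = D · Q · y` with `b ∈ Â`, `Q` a unit and `D`
dividing a power of `h` in `S` (`LocAtCentreDenominators.lean`); after Lemma 4.7, `h` is a unit
times a monomial in the prime elements `û₁, …, û_r`, hence so is `D`, and `b` is an element of
`Â` of the shape `unit · monomial(û) · y` — the input of the density step (512)
(`exists_rsp_powers_of_cp511_of_shape`, `exists_adjoin_isRegularLocalRing_of_lemma47State`).

* `exists_units_mul_prod_pow_mul_of_dvd_pow_monomial` — if `D ∣ F^N`, `F = w ∏_j u_j^{α_j}`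
  with `w` a unit and the `u_j` prime, and `b = D Q y` with `Q` a unit, then
  `b = ε (∏_j u_j^{m_j}) y` with `ε` a unit.

## Sources

* V. Cossart, O. Piltant, J. Algebra 529 (2019) 268–535 = arXiv:1412.0868, proof of Prop. 4.8,
  (510)–(512) (arXiv v1: Prop. 4.6, p. 53). [CossartPiltant2019]
-/

noncomputable section

namespace Literature.AlgebraicGeometry.Resolution

universe u

/-- **Shape elements from denominators dividing a power of a monomial.** In a domain `S`, let
`u₁, …, u_r` be prime elements and `F = w ∏_j u_j^{α_j}` with `w` a unit (in the source: `h`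
after Lemma 4.7, `√(h𝒪_{Ŷ,ŷ}) = (û₁ ⋯ û_r)`). If `D ∣ F^N` and `b = D Q y` with `Q` a unit (the
denominator clause of the model, (510)), then `b = ε (∏_j u_j^{m_j}) y` for a unit `ε` and
exponents `m_j` — an element of the shape required by (512).
[cite: CossartPiltant2019, proof of Prop. 4.8, (510)–(512) (arXiv v1: Prop. 4.6, p. 53)] -/
theorem exists_units_mul_prod_pow_mul_of_dvd_pow_monomial {S : Type u} [CommRing S] [IsDomain S]
    {r : ℕ} (u : Fin r → S) (hu : ∀ j, Prime (u j)) (F : S) (w : Sˣ) (α : Fin r → ℕ)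
    (hF : F = w * ∏ j, u j ^ α j) {D : S} {N : ℕ} (hD : D ∣ F ^ N)
    {b y : S} (Q : Sˣ) (hb : b = D * Q * y) :
    ∃ (ε : Sˣ) (m : Fin r → ℕ), b = ε * (∏ j, u j ^ m j) * y := by
  classical
  -- `D ∣ ∏ u_j ^ (N α_j)` (the unit `w^N` is irrelevant)
  have hFN : F ^ N = (w ^ N : Sˣ) * ∏ j, u j ^ (N * α j) := by
    rw [hF, mul_pow, Units.val_pow_eq_pow_val, ← Finset.prod_pow]
    congr 1
    exact Finset.prod_congr rfl fun j _ => by rw [← pow_mul, mul_comm]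
  have hD' : D ∣ ∏ j, u j ^ (N * α j) := by
    have h1 : D ∣ (w ^ N : Sˣ) * ∏ j, u j ^ (N * α j) := hFN ▸ hD
    exact (Units.dvd_mul_left).mp h1
  obtain ⟨γ, m, hγ⟩ := CossartPiltantMonomial.exists_eq_units_mul_prod_pow_of_dvd hu _ hD'
  refine ⟨γ * Q, m, ?_⟩
  rw [hb, hγ, Units.val_mul]
  ring

end Literature.AlgebraicGeometry.Resolution

end
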